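import Literature.Computability.QuantumComplexity.HidingProgram
import Literature.Analysis.Matrix.GramSchmidtPlantedEstimate
import Literature.Analysis.Matrix.NearOrthogonalIndependent
import HarnessLib

/-!
# The ideal world of the proof of AA13 Thm. 1.3: the deterministic core of the estimate

Family `quantum-advantage`. On the good event of the union bound of the discharge of
Aaronson–Arkhipov's Thm. 1.3 (Gram matrix of the planted array `B'` near `N₀ · 1`, perturbation sum
and planted permanent not too large, oracle mass `q` close to the planted probability, counter
estimate `q̃` relatively accurate) the machine's answer `z = zOf b n Ñ ℓ (∏ d_odd) (∏ d_even)` is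
close to `|Per(X̃/2ᵇ)|²`. This file is the deterministic algebra of that step:

* `norm_apply_le_one_of_isColumnOrthonormal` — entries of `U ∈ 𝒰_{M,n}` are `≤ 1` (so the
  clamp of `hiddenOf` is a no-op, `hiddenOf_eq_roundEntries`);
* `norm_sq_permanent_gaussInt_submatrix` — `|Per X|² = 4^{bn} |Per(X̃/2ᵇ)|²` for the integer block
  `X = B'_S`;
* `prod_norm_gramSchmidt_sq_eq` — `∏‖b*_k‖² = ∏ d_{2k+1} / ∏ d_{2k}` (Cohen's `d`'s);
* `abs_zOf_div_sub_le` — the final floor: `|z/4ᵇ - (Ñ/2^ℓ) n! (∏‖b*‖²)/4^{bn}| ≤ 4^{-b}`;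
* **`core_est_bound`** — `abs_est_sub_norm_sq_permanent_le` with the Markov bounds substituted:
  `|q̃ n! ∏‖b*‖² - |Per X|²| ≤ (2P + Z)Z + (P² + (2P+Z)Z)/kη + n!((1+t)N₀)ⁿ θ₂ (1 + 1/kη)`;
* **`core_answer_bound`** — the two combined, divided by `4^{bn}`.

All proved, no new named facts.

## References

* S. Aaronson, A. Arkhipov, *The computational complexity of linear optics*, Theory of Computing 9
  (2013) 143–252, proof of Thm. 1.3, eqs. (5.89), (5.93)–(5.95) (pp. 194–195).
-/

noncomputable section

namespace Literature.Computability.QuantumComplexity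

open Finset Matrix InnerProductSpace Literature.Computability.Cryptography Literature.LinearAlgebra.Matrix
  Literature.Analysis.Matrix Literature.Algebra.EuclideanLattices

variable {M n : ℕ}

/-! ### Entries of column-orthonormal matrices -/

/-- **Entries of a column-orthonormal matrix have modulus `≤ 1`** (`∑_r |U r c|² = 1`). [folklore] -/
theorem norm_apply_le_one_of_isColumnOrthonormal {U : _root_.Matrix (Fin M) (Fin n) ℂ} (hU : IsColumnOrthonormal U)
    (r : Fin M) (c : Fin n) : ‖U r c‖ ≤ 1 := by
  have h := congrFun (congrFun hU c) c
  rw [Matrix.mul_apply, Matrix.one_apply_eq] at h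
  simp only [conjTranspose_apply, RCLike.star_def] at h
  have h2 : ∑ x, (starRingEnd ℂ) (U x c) * U x c = ∑ x, ((‖U x c‖ ^ 2 : ℝ) : ℂ) := by
    refine Finset.sum_congr rfl fun x _ => ?_
    rw [Complex.conj_mul']
    push_cast
    rfl
  rw [h2, ← Complex.ofReal_sum] at h
  have h3 : ∑ x, ‖U x c‖ ^ 2 = 1 := by exact_mod_cast h
  have h4 : ‖U r c‖ ^ 2 ≤ 1 := by
    rw [← h3]
    exact Finset.single_le_sum (f := fun x => ‖U x c‖ ^ 2) (fun x _ => sq_nonneg _) (mem_univ r)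
  nlinarith [norm_nonneg (U r c)]

/-! ### The integer block and the dyadic block -/

/-- The integer block is `2ᵇ` times the dyadic block. [folklore] -/
theorem gaussIntMatrix_submatrix_eq_smul (b : ℕ) (B' : _root_.Matrix (Fin M) (Fin n) (ℤ × ℤ)) (S : Fin n → Fin M) :
    (gaussIntMatrix B').submatrix S id = ((2 : ℂ) ^ b) • _root_.Matrix.of (fun i j => dyadicComplex b (B' (S i) j)) := by
  ext i j
  simp only [submatrix_apply, id_eq, gaussIntMatrix, of_apply, Matrix.smul_apply, smul_eq_mul, dyadicComplex]
  rw [mul_div_cancel₀ _ (pow_ne_zero _ two_ne_zero)]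

/-- **`|Per X|² = 4^{bn} |Per(X̃/2ᵇ)|²`** for the integer block `X = B'_S`. [folklore] -/
theorem norm_sq_permanent_gaussInt_submatrix (b : ℕ) (B' : _root_.Matrix (Fin M) (Fin n) (ℤ × ℤ)) (S : Fin n → Fin M) :
    ‖((gaussIntMatrix B').submatrix S id).permanent‖ ^ 2 =
      (4 : ℝ) ^ (b * n) * ‖(_root_.Matrix.of fun i j => dyadicComplex b (B' (S i) j)).permanent‖ ^ 2 := by
  rw [gaussIntMatrix_submatrix_eq_smul, permanent_smul, Fintype.card_fin, norm_mul, norm_pow, norm_pow, mul_pow]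
  congr 1
  rw [Complex.norm_two, ← pow_mul, ← pow_mul, show (4 : ℝ) = 2 ^ 2 by norm_num, ← pow_mul]
  congr 1
  ring

/-! ### The product of the Gram–Schmidt norms as a ratio of Cohen's `d`'s -/

/-- **`∏‖b*_k‖² = (∏_k d_{2k+1}) / (∏_k d_{2k})`.** [folklore] -/
theorem prod_norm_gramSchmidt_sq_eq (B' : _root_.Matrix (Fin M) (Fin n) (ℤ × ℤ))
    (hli : LinearIndependent ℂ (colVec (gaussIntMatrix B'))) :
    ∏ k, ‖gramSchmidt ℂ (colVec (gaussIntMatrix B')) k‖ ^ 2 =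
      (∏ k : Fin n, (dRec (extFamily B') (2 * k + 1) : ℝ)) / ∏ k : Fin n, (dRec (extFamily B') (2 * k) : ℝ) := by
  rw [← Finset.prod_div_distrib]
  exact Finset.prod_congr rfl fun k _ => norm_gramSchmidt_sq_eq_dRec_div B' hli k

/-- The `d`-products are positive. [folklore] -/
theorem prod_dRec_pos (B' : _root_.Matrix (Fin M) (Fin n) (ℤ × ℤ)) (hli : LinearIndependent ℂ (colVec (gaussIntMatrix B')))
    (a : ℕ) (ha : a ≤ 1) : 0 < ∏ k : Fin n, dRec (extFamily B') (2 * k + a) :=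
  Finset.prod_pos fun k _ => dRec_extFamily_pos B' hli _ (by omega)

/-! ### The final floor -/

/-- `x - 1 < ⌊x⌋` for natural division. [folklore] -/
theorem sub_one_lt_cast_div {A D : ℕ} (hD : 0 < D) : (A : ℝ) / D - 1 < ((A / D : ℕ) : ℝ) := by
  have h := Nat.div_add_mod A D
  have hm := Nat.mod_lt A hD
  have hD' : (0 : ℝ) < D := by exact_mod_cast hD
  rw [div_sub_one hD'.ne', div_lt_iff₀ hD']
  have : ((A : ℕ) : ℝ) = D * (A / D : ℕ) + (A % D : ℕ) := by exact_mod_cast h.symm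
  rw [this]
  have hm' : ((A % D : ℕ) : ℝ) < D := by exact_mod_cast hm
  nlinarith

/-- **The floor of the answer**: with `d_odd, d_even > 0`,
`|zOf/4ᵇ - (Ñ/2^ℓ) n! (d_odd/d_even) / 4^{bn}| ≤ 4^{-b}`. [cite: AaronsonArkhipovToC2013, proof of Thm. 1.3, eq. (5.93) (p. 195)] -/
theorem abs_zOf_div_sub_le (b n N ℓ : ℕ) {dodd deven : ℤ} (ho : 0 < dodd) (he : 0 < deven) :
    |(zOf b n N ℓ dodd deven : ℝ) / 4 ^ b - (N : ℝ) / 2 ^ ℓ * n.factorial * ((dodd : ℝ) / deven) / 4 ^ (b * n)| ≤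
      1 / 4 ^ b := by
  have h4 : (0 : ℝ) < 4 ^ b := by positivity
  have hD : 0 < 2 ^ ℓ * 4 ^ (b * n) * deven.toNat := by
    have : 0 < deven.toNat := by omega
    positivity
  have hlow := sub_one_lt_cast_div (A := 4 ^ b * n.factorial * N * dodd.toNat) hD
  have hup := Nat.cast_div_le (α := ℝ) (m := 4 ^ b * n.factorial * N * dodd.toNat) (n := 2 ^ ℓ * 4 ^ (b * n) * deven.toNat)
  have hoR : ((dodd.toNat : ℕ) : ℝ) = (dodd : ℝ) := by
    rw [show ((dodd.toNat : ℕ) : ℝ) = ((dodd.toNat : ℤ) : ℝ) by norm_cast, Int.toNat_of_nonneg ho.le]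
  have heR : ((deven.toNat : ℕ) : ℝ) = (deven : ℝ) := by
    rw [show ((deven.toNat : ℕ) : ℝ) = ((deven.toNat : ℤ) : ℝ) by norm_cast, Int.toNat_of_nonneg he.le]
  have hdev : (0 : ℝ) < deven := by exact_mod_cast he
  have hkey : ((4 ^ b * n.factorial * N * dodd.toNat : ℕ) : ℝ) / ((2 ^ ℓ * 4 ^ (b * n) * deven.toNat : ℕ) : ℝ) =
      4 ^ b * ((N : ℝ) / 2 ^ ℓ * n.factorial * ((dodd : ℝ) / deven) / 4 ^ (b * n)) := by
    push_cast
    rw [hoR, heR]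
    field_simp
  rw [hkey] at hlow hup
  unfold zOf
  set z : ℝ := ((4 ^ b * n.factorial * N * dodd.toNat / (2 ^ ℓ * 4 ^ (b * n) * deven.toNat) : ℕ) : ℝ) with hz
  set X : ℝ := (N : ℝ) / 2 ^ ℓ * n.factorial * ((dodd : ℝ) / deven) / 4 ^ (b * n) with hX
  have hrw : z / 4 ^ b - X = (z - 4 ^ b * X) / 4 ^ b := by field_simp
  rw [hrw, abs_div, abs_of_pos h4, div_le_div_iff_of_pos_right h4, abs_le]
  constructor <;> linarith

/-! ### The analytic core with the Markov bounds substituted -/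

/-- **The deterministic core of the union bound.** For the planted array `B` (columns' Gram matrix
within `t N₀` of `N₀ · 1`, `8tn ≤ 1`, `t ≤ 1/4`), `X = B_S`, perturbation sum `Z_{8t}(X) ≤ Z`,
`|Per X| ≤ P`, oracle mass `|q - |Per U_S|²/n!| ≤ θ₂`, counter `|q̃ - q| ≤ q/kη`:
`|q̃ n! ∏‖b*‖² - |Per X|²| ≤ (2P + Z)Z + (P² + (2P+Z)Z)/kη + n!((1+t)N₀)ⁿ θ₂ (1 + 1/kη)`.
[cite: AaronsonArkhipovToC2013, proof of Thm. 1.3, eqs. (5.89), (5.93)–(5.95) (pp. 194–195)] -/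
theorem core_est_bound (B : _root_.Matrix (Fin M) (Fin n) ℂ) (S : Fin n → Fin M) {N₀ t : ℝ}
    (hG : ∀ i j, ‖(Bᴴ * B) i j - (if i = j then (N₀ : ℂ) else 0)‖ ≤ t * N₀) (hN₀ : 0 < N₀) (ht0 : 0 ≤ t)
    (htn : 8 * t * n ≤ 1) (ht4 : t ≤ 1 / 4) {Z Pr q qt θ₂ kη : ℝ}
    (hZ : perturbSum (8 * t) (B.submatrix S id) ≤ Z) (hPr : ‖(B.submatrix S id).permanent‖ ≤ Pr) (hkη : 0 < kη)
    (hq : |q - ‖((gsUnit B).submatrix S id).permanent‖ ^ 2 / n.factorial| ≤ θ₂) (hqt : |qt - q| ≤ q / kη) :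
    |qt * n.factorial * ∏ k, ‖gramSchmidt ℂ (colVec B) k‖ ^ 2 - ‖(B.submatrix S id).permanent‖ ^ 2| ≤
      (2 * Pr + Z) * Z + (Pr ^ 2 + (2 * Pr + Z) * Z) / kη + n.factorial * ((1 + t) * N₀) ^ n * θ₂ * (1 + 1 / kη) := by
  have h0 := gramSchmidt_ne_zero_of_nearOrthogonal (nearOrthogonal_colVec hG) hN₀ ht0 htn ht4
  have hT : ∀ j k, ‖(tMatrix B - 1) j k‖ ≤ 8 * t := norm_tMatrix_sub_one_le hG hN₀ ht0 htn ht4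
  have hcore := abs_est_sub_norm_sq_permanent_le B S h0 hT hZ hkη hq hqt
  have hZ0 : 0 ≤ Z := (perturbSum_nonneg (by positivity) _).trans hZ
  have hP0 : 0 ≤ ‖(B.submatrix S id).permanent‖ := norm_nonneg _
  have hθ : 0 ≤ θ₂ := (abs_nonneg _).trans hq
  have hW : ∏ k, ‖gramSchmidt ℂ (colVec B) k‖ ^ 2 ≤ ((1 + t) * N₀) ^ n := by
    calc ∏ k, ‖gramSchmidt ℂ (colVec B) k‖ ^ 2 ≤ ∏ _k : Fin n, ((1 + t) * N₀) :=
          Finset.prod_le_prod (fun k _ => sq_nonneg _) fun k _ => (norm_gramSchmidt_colVec_sq_bounds hG hN₀ ht0 htn ht4 k).2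
      _ = ((1 + t) * N₀) ^ n := by rw [Finset.prod_const, card_univ, Fintype.card_fin]
  have hW0 : 0 ≤ ∏ k, ‖gramSchmidt ℂ (colVec B) k‖ ^ 2 := Finset.prod_nonneg fun k _ => sq_nonneg _
  refine hcore.trans ?_
  set Pm := ‖(B.submatrix S id).permanent‖ with hPm
  set W := ∏ k, ‖gramSchmidt ℂ (colVec B) k‖ ^ 2 with hWdef
  have h1 : (2 * Pm + Z) * Z ≤ (2 * Pr + Z) * Z := by nlinarith
  have h2 : (Pm ^ 2 + (2 * Pm + Z) * Z) / kη ≤ (Pr ^ 2 + (2 * Pr + Z) * Z) / kη := by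
    refine div_le_div_of_nonneg_right ?_ hkη.le
    nlinarith
  have h3 : n.factorial * W * θ₂ * (1 + 1 / kη) ≤ n.factorial * ((1 + t) * N₀) ^ n * θ₂ * (1 + 1 / kη) := by
    have hk1 : 0 ≤ 1 + 1 / kη := by positivity
    have hnf : (0 : ℝ) ≤ n.factorial := by positivity
    have := mul_le_mul_of_nonneg_left hW hnf
    have := mul_le_mul_of_nonneg_right this hθ
    exact mul_le_mul_of_nonneg_right this hk1
  linarith

/-- **The answer on the good event.** With `X = B'_S` the integer block, `d_odd = ∏ d_{2k+1}`,
`d_even = ∏ d_{2k}`, `q̃ = Ñ/2^ℓ`: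
`|zOf/4ᵇ - |Per(X̃/2ᵇ)|²| ≤ [(2P+Z)Z + (P² + (2P+Z)Z)/kη + n!((1+t)N₀)ⁿ θ₂ (1+1/kη)]/4^{bn} + 4^{-b}`.
[cite: AaronsonArkhipovToC2013, proof of Thm. 1.3, eqs. (5.89), (5.93)–(5.95) (pp. 194–195)] -/
theorem core_answer_bound (b : ℕ) (B' : _root_.Matrix (Fin M) (Fin n) (ℤ × ℤ)) (S : Fin n → Fin M) {N₀ t : ℝ}
    (hG : ∀ i j, ‖((gaussIntMatrix B')ᴴ * gaussIntMatrix B') i j - (if i = j then (N₀ : ℂ) else 0)‖ ≤ t * N₀)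
    (hN₀ : 0 < N₀) (ht0 : 0 ≤ t) (htn : 8 * t * n ≤ 1) (ht4 : t ≤ 1 / 4) (htn' : t * n < 1) {Z Pr q θ₂ kη : ℝ} {N ℓ : ℕ}
    (hZ : perturbSum (8 * t) ((gaussIntMatrix B').submatrix S id) ≤ Z)
    (hPr : ‖((gaussIntMatrix B').submatrix S id).permanent‖ ≤ Pr) (hkη : 0 < kη)
    (hq : |q - ‖((gsUnit (gaussIntMatrix B')).submatrix S id).permanent‖ ^ 2 / n.factorial| ≤ θ₂)
    (hqt : |(N : ℝ) / 2 ^ ℓ - q| ≤ q / kη) :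
    |(zOf b n N ℓ (∏ k : Fin n, dRec (extFamily B') (2 * k + 1)) (∏ k : Fin n, dRec (extFamily B') (2 * k)) : ℝ) / 4 ^ b -
        ‖(_root_.Matrix.of fun i j => dyadicComplex b (B' (S i) j)).permanent‖ ^ 2| ≤
      ((2 * Pr + Z) * Z + (Pr ^ 2 + (2 * Pr + Z) * Z) / kη + n.factorial * ((1 + t) * N₀) ^ n * θ₂ * (1 + 1 / kη)) /
          4 ^ (b * n) + 1 / 4 ^ b := by
  have hli := linearIndependent_colVec_gaussIntMatrix_of_gram hG hN₀ htn'
  have hest := core_est_bound (gaussIntMatrix B') S hG hN₀ ht0 htn ht4 hZ hPr hkη hq hqt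
  have hfloor := abs_zOf_div_sub_le b n N ℓ (prod_dRec_pos B' hli 1 le_rfl) (prod_dRec_pos B' hli 0 (by norm_num))
  have h4 : (0 : ℝ) < 4 ^ (b * n) := by positivity
  -- rewrite the integer block and the `d`-ratio
  rw [prod_norm_gramSchmidt_sq_eq B' hli, norm_sq_permanent_gaussInt_submatrix b B' S] at hest
  simp only [Nat.add_zero] at hfloor
  push_cast at hfloor
  set est : ℝ := (N : ℝ) / 2 ^ ℓ * n.factorial *
    ((∏ k : Fin n, (dRec (extFamily B') (2 * k + 1) : ℝ)) / ∏ k : Fin n, (dRec (extFamily B') (2 * k) : ℝ)) with hest_def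
  set z : ℝ := (zOf b n N ℓ (∏ k : Fin n, dRec (extFamily B') (2 * k + 1)) (∏ k : Fin n, dRec (extFamily B') (2 * k)) : ℝ)
  set p : ℝ := ‖(_root_.Matrix.of fun i j => dyadicComplex b (B' (S i) j)).permanent‖ ^ 2
  -- `|est - 4^{bn} p| ≤ Err` gives `|est/4^{bn} - p| ≤ Err/4^{bn}`
  have hdiv : |est / 4 ^ (b * n) - p| ≤
      ((2 * Pr + Z) * Z + (Pr ^ 2 + (2 * Pr + Z) * Z) / kη + n.factorial * ((1 + t) * N₀) ^ n * θ₂ * (1 + 1 / kη)) /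
        4 ^ (b * n) := by
    rw [show est / 4 ^ (b * n) - p = (est - 4 ^ (b * n) * p) / 4 ^ (b * n) by field_simp, abs_div, abs_of_pos h4]
    exact div_le_div_of_nonneg_right hest h4.le
  calc |z / 4 ^ b - p| = |(z / 4 ^ b - est / 4 ^ (b * n)) + (est / 4 ^ (b * n) - p)| := by ring_nf
    _ ≤ |z / 4 ^ b - est / 4 ^ (b * n)| + |est / 4 ^ (b * n) - p| := abs_add_le _ _
    _ ≤ 1 / 4 ^ b + ((2 * Pr + Z) * Z + (Pr ^ 2 + (2 * Pr + Z) * Z) / kη +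
          n.factorial * ((1 + t) * N₀) ^ n * θ₂ * (1 + 1 / kη)) / 4 ^ (b * n) := add_le_add hfloor hdiv
    _ = _ := by ring

end Literature.Computability.QuantumComplexity
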